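import Literature.Probability.LatticeModels.ScaleFrameQuasiMultArms
import Literature.Probability.LatticeModels.RandomClusterFKG
import HarnessLib

/-!
# Quasi-multiplicativity on a scale frame, lower bound (Kesten 1986, eqs. (29)–(30)) (proved)

Topic `Literature/Probability/LatticeModels` (trunk `StatMech`, family `crit-ising`). For the
random-cluster measure `ν` of the frame edges inside a vertex set `W` with an inner blob `R'`
(radius `≤ a`) and an outer blob `Y` (radius `> aM^14 - η`) wired into one boundary cluster, the open
connection `R' ↔ Y in W` has probability at least `c^5 g₁ g₂`, where `g₁`, `g₂` are the inner and outer
arm probabilities of the quasi-multiplicativity UPPER bound (arm inside `U₁ = W ∩ {rad < aM^6}` with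
the layer `{rad ≥ aM^6 - η}` wired to `R'`, resp. inside `U₂ = W ∩ {rad > aM^8}` with the layer
`{rad ≤ aM^8 + η}` wired to `Y`) and `c` is the constant of an RSW ladder `LadderRSWb p q c a M 14 13`:

* `rcMeasure_real_inter₅_ge` — FKG for five increasing events;
* `rcMeasure_real_free_sub_le` — the free measure of a sub-edge-set is dominated on increasing events
  by any wired ambient measure (gives `ν(separator) ≥ c`, `ν(radial crossing) ≥ c` from the ladder);
* `ScaleFrame.quasiMult_lower` — Kesten's gluing: the two arms (`ScaleFrameQuasiMultArms`), open
  separators of `(aM^2, aM^3)` and `(aM^11, aM^12)` and an open radial crossing of `(aM^2, aM^13)`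
  occur together with probability `≥ c^5 g₁ g₂` (FKG) and force `R' ↔ Y in W`
  (`ScaleFrame.openCrossing_of_arms_seps_radCross`).

## References
* [Kesten1986] H. Kesten, Probab. Theory Related Fields 73 (1986) 369–394, §2 eqs. (26)–(30).
* [BasuSapozhnikov2017ECP] D. Basu, A. Sapozhnikov, ECP 22 (2017) no. 26, §§2, 5.
* G. Grimmett, *The Random-Cluster Model*, Springer (2006): Thm. (3.8), Lemma (4.14).
-/

noncomputable section

open MeasureTheory Finset SimpleGraph
open Literature.Probability.Percolation (BondConfig openConnIn openCrossing isUpperSet_openCrossing)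

namespace Literature.Probability.LatticeModels

variable {V : Type*} [Fintype V] [DecidableEq V]

/-! ### Measure tools -/

section MeasureTools

/-- **FKG for five increasing events** under a random-cluster measure (`0 ≤ p ≤ 1`, `q ≥ 1`).
[cite: Grimmett2006, Thm. (3.8)] -/
theorem rcMeasure_real_inter₅_ge (G : SimpleGraph V) [DecidableRel G.Adj] {p q : ℝ}
    (hp : p ∈ Set.Icc (0 : ℝ) 1) (hq : 1 ≤ q) (B : Set V) {A₁ A₂ A₃ A₄ A₅ : Set (BondConfig V)}
    (h₁ : IsUpperSet A₁) (h₂ : IsUpperSet A₂) (h₃ : IsUpperSet A₃) (h₄ : IsUpperSet A₄)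
    (h₅ : IsUpperSet A₅) :
    (rcMeasure G p q B).real A₁ * (rcMeasure G p q B).real A₂ * (rcMeasure G p q B).real A₃ *
        (rcMeasure G p q B).real A₄ * (rcMeasure G p q B).real A₅ ≤
      (rcMeasure G p q B).real (A₁ ∩ A₂ ∩ A₃ ∩ A₄ ∩ A₅) := by
  have h12 := rcMeasure_fkg_holds G hp hq B h₁ h₂
  have h123 := rcMeasure_fkg_holds G hp hq B (h₁.inter h₂) h₃
  have h1234 := rcMeasure_fkg_holds G hp hq B ((h₁.inter h₂).inter h₃) h₄
  have h12345 := rcMeasure_fkg_holds G hp hq B (((h₁.inter h₂).inter h₃).inter h₄) h₅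
  have n3 : 0 ≤ (rcMeasure G p q B).real A₃ := measureReal_nonneg
  have n4 : 0 ≤ (rcMeasure G p q B).real A₄ := measureReal_nonneg
  have n5 : 0 ≤ (rcMeasure G p q B).real A₅ := measureReal_nonneg
  calc _ ≤ (rcMeasure G p q B).real (A₁ ∩ A₂) * (rcMeasure G p q B).real A₃ *
        (rcMeasure G p q B).real A₄ * (rcMeasure G p q B).real A₅ :=
        mul_le_mul_of_nonneg_right (mul_le_mul_of_nonneg_right
          (mul_le_mul_of_nonneg_right h12 n3) n4) n5
    _ ≤ (rcMeasure G p q B).real (A₁ ∩ A₂ ∩ A₃) * (rcMeasure G p q B).real A₄ *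
        (rcMeasure G p q B).real A₅ :=
        mul_le_mul_of_nonneg_right (mul_le_mul_of_nonneg_right h123 n4) n5
    _ ≤ (rcMeasure G p q B).real (A₁ ∩ A₂ ∩ A₃ ∩ A₄) * (rcMeasure G p q B).real A₅ :=
        mul_le_mul_of_nonneg_right h1234 n5
    _ ≤ _ := h12345

/-- **The free measure of a sub-edge-set is dominated by any wired ambient measure on increasing
events**: `φ^∅_{⟨EA⟩}(A) ≤ φ^B_{⟨EW⟩}(A)` for `EA ⊆ EW`, `q ≥ 1`, `p < 1` (free ≤ wired on `⟨EA⟩`,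
then the closed-outside domain Markov comparison `rcMeasure_fromEdgeSet_real_le`).
[cite: Grimmett2006, Lemma (4.14)] -/
theorem rcMeasure_real_free_sub_le {p q : ℝ} (hp : p ∈ Set.Ico (0 : ℝ) 1) (hq : 1 ≤ q)
    {EW EA : Finset (Sym2 V)} (hEA : EA ⊆ EW) (B : Set V) {A : Set (BondConfig V)}
    (hA : IsUpperSet A) :
    (rcMeasure (fromEdgeSet (EA : Set (Sym2 V))) p q ∅).real A ≤
      (rcMeasure (fromEdgeSet (EW : Set (Sym2 V))) p q B).real A := by
  have hp' : p ∈ Set.Icc (0 : ℝ) 1 := ⟨hp.1, hp.2.le⟩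
  have hq0 : 0 < q := one_pos.trans_le hq
  haveI := isProbabilityMeasure_rcMeasure (fromEdgeSet (EW : Set (Sym2 V))) hp' hq0 B
  have hU : ∀ i : Fintype (fromEdgeSet (EW : Set (Sym2 V))).edgeSet,
      EA.filter (fun e => ¬ e.IsDiag) ⊆ @edgeFinset V (fromEdgeSet (EW : Set (Sym2 V))) i :=
    fun i e he => by
      rw [Finset.mem_filter] at he
      exact (mem_edgeFinset_fromEdgeSet_iff EW i e).2 ⟨hEA he.1, he.2⟩
  calc (rcMeasure (fromEdgeSet (EA : Set (Sym2 V))) p q ∅).real A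
      ≤ (rcMeasure (fromEdgeSet (EA : Set (Sym2 V))) p q B).real A :=
        rcMeasure_real_mono_wired_of_isUpperSet _ hp' hq (Set.empty_subset B) hA
    _ = (rcMeasure (fromEdgeSet (↑(EA.filter fun e => ¬ e.IsDiag) : Set (Sym2 V))) p q B).real A := by
        rw [rcMeasure_congr_graph (fromEdgeSet_coe_filter_not_isDiag EA) p q B]
    _ ≤ (rcMeasure (fromEdgeSet (EW : Set (Sym2 V))) p q B).real
          {ω | ω ∩ ↑(EA.filter fun e => ¬ e.IsDiag) ∈ A} :=
        rcMeasure_fromEdgeSet_real_le _ hp' hq B _ (hU _)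
          (rcMeasure_real_cylinder_empty_pos _ hp' hp.2 hq0 B _) hA
    _ ≤ (rcMeasure (fromEdgeSet (EW : Set (Sym2 V))) p q B).real A :=
        measureReal_mono fun ω hω => hA Set.inter_subset_left hω

end MeasureTools

namespace ScaleFrame

variable (F : ScaleFrame V)

/-! ### Kesten's gluing: the lower bound of quasi-multiplicativity -/

/-- **Quasi-multiplicativity, lower bound** (Kesten 1986, eqs. (29)–(30)), all hypotheses explicit:
`c^5 g₁ g₂ ≤ ν(R' ↔ Y in W)`. [cite: Kesten1986, §2 eqs. (29)–(30)] -/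
theorem quasiMult_lower_aux {p q c a M : ℝ} (hp : p ∈ Set.Ico (0 : ℝ) 1) (hq : 1 ≤ q) (hc : 0 < c)
    (ha : 0 < a) (hM : 4 ≤ M) (hRm : a * M ^ 15 ≤ F.Rmax) (hη : F.η ≤ a)
    (hL : F.LadderRSWb p q c a M 14 13) (W R' Y : Set V)
    (hW : ∀ v ∈ W, v ∈ F.good ∧ F.rad v < a * M ^ 15) (hR'W : R' ⊆ W) (hYW : Y ⊆ W)
    (hband : ∀ v : V, v ∈ F.good → a < F.rad v → F.rad v < a * M ^ 14 → v ∈ W)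
    (hR' : ∀ v ∈ R', F.rad v ≤ a) (hY : ∀ v ∈ Y, a * M ^ 14 - F.η < F.rad v) :
    c ^ 5 * (rcMeasure (fromEdgeSet (↑(F.edgesWithin (W ∩ {v | F.rad v < a * M ^ 6})) : Set (Sym2 V)))
        p q (R' ∪ {v | a * M ^ 6 - F.η ≤ F.rad v})).real
        (openCrossing (W ∩ {v | F.rad v < a * M ^ 6}) R'
          ((W ∩ {v | F.rad v < a * M ^ 6}) ∩ {v | a * M ^ 3 ≤ F.rad v})) *
      (rcMeasure (fromEdgeSet (↑(F.edgesWithin (W ∩ {v | a * M ^ 8 < F.rad v})) : Set (Sym2 V)))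
        p q (Y ∪ {v | F.rad v ≤ a * M ^ 8 + F.η})).real
        (openCrossing (W ∩ {v | a * M ^ 8 < F.rad v})
          ((W ∩ {v | a * M ^ 8 < F.rad v}) ∩ {v | F.rad v ≤ a * M ^ 11}) Y) ≤
      (rcMeasure (fromEdgeSet (↑(F.edgesWithin W) : Set (Sym2 V))) p q (R' ∪ Y)).real
        (openCrossing W R' Y) := by
  obtain ⟨hstep, hak, hmono⟩ := quasiMult_scales ha hM
  have hp' : p ∈ Set.Icc (0 : ℝ) 1 := ⟨hp.1, hp.2.le⟩
  have hq0 : 0 < q := one_pos.trans_le hq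
  have hη0 := F.η_pos
  have s0 : 4 * (a * M ^ 0) ≤ a * M ^ 1 := hstep 0
  have s1 : 4 * (a * M ^ 1) ≤ a * M ^ 2 := hstep 1
  have s2 : 4 * (a * M ^ 2) ≤ a * M ^ 3 := hstep 2
  have s11 : 4 * (a * M ^ 11) ≤ a * M ^ 12 := hstep 11
  have s12 : 4 * (a * M ^ 12) ≤ a * M ^ 13 := hstep 12
  have s13 : 4 * (a * M ^ 13) ≤ a * M ^ 14 := hstep 13
  have s14 : 4 * (a * M ^ 14) ≤ a * M ^ 15 := hstep 14
  have e0 : a * M ^ 0 = a := by rw [pow_zero, mul_one]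
  rw [e0] at s0
  have m3_11 := hmono 3 11 (by norm_num)
  have m13 := hak 13
  set ν := rcMeasure (fromEdgeSet (↑(F.edgesWithin W) : Set (Sym2 V))) p q (R' ∪ Y) with hν
  haveI := isProbabilityMeasure_rcMeasure (fromEdgeSet (↑(F.edgesWithin W) : Set (Sym2 V))) hp' hq0
    (R' ∪ Y)
  set U₁ : Set V := W ∩ {v | F.rad v < a * M ^ 6} with hU₁
  set U₂ : Set V := W ∩ {v | a * M ^ 8 < F.rad v} with hU₂
  set A₁ := openCrossing U₁ R' (U₁ ∩ {v | a * M ^ 3 ≤ F.rad v}) with hA₁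
  set A₂ := openCrossing U₂ (U₂ ∩ {v | F.rad v ≤ a * M ^ 11}) Y with hA₂
  set S₁ := F.sepEvent (a * M ^ 2) (a * M ^ 3) with hS₁
  set S₂ := F.sepEvent (a * M ^ 11) (a * M ^ 12) with hS₂
  set Rd := F.radCross (a * M ^ 2) (a * M ^ 13) with hRd
  -- the five lower bounds
  have h5 := F.arm_inner_lower hp hq hc ha hM hRm hη
    (ScaleFrame.LadderRSWb.noCrossBound F hL (by norm_num) (i := 4) (by norm_num))
    hW hR'W hband hR' hY
  have h6 := F.arm_outer_lower hp hq hc ha hM hRm hη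
    (ScaleFrame.LadderRSWb.noCrossBound F hL (by norm_num) (i := 9) (by norm_num))
    hW hYW hband hR' hY
  have hSep₁ : F.SepBound p q c (a * M ^ 2) (a * M ^ 3) :=
    ScaleFrame.LadderRSWb.sepBound F hL (by norm_num) (i := 2) (by norm_num)
  have hSep₂ : F.SepBound p q c (a * M ^ 11) (a * M ^ 12) :=
    ScaleFrame.LadderRSWb.sepBound F hL (by norm_num) (i := 11) (by norm_num)
  have hRad : F.RadialBound p q c (a * M ^ 2) (a * M ^ 13) :=
    ScaleFrame.LadderRSWb.radialBound F hL (i := 2) (j := 13) (by norm_num) (by norm_num) (by norm_num)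
  have hE₁ : F.edgesTouching (F.annSet (a * M ^ 2) (a * M ^ 3)) ⊆ F.edgesWithin W := fun e he =>
    F.mem_edgesWithin.2 ⟨(F.mem_edgesTouching.1 he).1, fun x hx => by
      obtain ⟨hxg, h1, h2⟩ :=
        F.rad_of_mem_edgesTouching_annSet ((hmono 3 15 (by norm_num)).trans hRm) he hx
      exact hband x hxg (by linarith) (by linarith [hmono 3 13 (by norm_num)])⟩
  have hE₂ : F.edgesTouching (F.annSet (a * M ^ 11) (a * M ^ 12)) ⊆ F.edgesWithin W := fun e he =>
    F.mem_edgesWithin.2 ⟨(F.mem_edgesTouching.1 he).1, fun x hx => by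
      obtain ⟨hxg, h1, h2⟩ :=
        F.rad_of_mem_edgesTouching_annSet ((hmono 12 15 (by norm_num)).trans hRm) he hx
      exact hband x hxg (by linarith [hmono 1 11 (by norm_num)]) (by linarith)⟩
  have hE₃ : F.edgesTouching (F.annSet (a * M ^ 2 / 2) (2 * (a * M ^ 13))) ⊆ F.edgesWithin W :=
    fun e he => F.mem_edgesWithin.2 ⟨(F.mem_edgesTouching.1 he).1, fun x hx => by
      obtain ⟨hxg, h1, h2⟩ :=
        F.rad_of_mem_edgesTouching_annSet (s' := 2 * (a * M ^ 13)) (by linarith) he hx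
      exact hband x hxg (by linarith) (by linarith)⟩
  have h3 : c ≤ ν.real S₁ :=
    hSep₁.trans (rcMeasure_real_free_sub_le hp hq hE₁ (R' ∪ Y) (F.isUpperSet_sepEvent _ _))
  have h3' : c ≤ ν.real S₂ :=
    hSep₂.trans (rcMeasure_real_free_sub_le hp hq hE₂ (R' ∪ Y) (F.isUpperSet_sepEvent _ _))
  have h4 : c ≤ ν.real Rd :=
    hRad.trans (rcMeasure_real_free_sub_le hp hq hE₃ (R' ∪ Y) (F.isUpperSet_radCross _ _))
  -- FKG
  have hfkg := rcMeasure_real_inter₅_ge (fromEdgeSet (↑(F.edgesWithin W) : Set (Sym2 V))) hp' hq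
    (R' ∪ Y) (isUpperSet_openCrossing _ _ _ : IsUpperSet A₁) (F.isUpperSet_sepEvent _ _ : IsUpperSet S₁)
    (F.isUpperSet_radCross _ _ : IsUpperSet Rd) (F.isUpperSet_sepEvent _ _ : IsUpperSet S₂)
    (isUpperSet_openCrossing _ _ _ : IsUpperSet A₂)
  -- gluing
  have hglue : ν.real (A₁ ∩ S₁ ∩ Rd ∩ S₂ ∩ A₂) ≤ ν.real (openCrossing W R' Y) := by
    refine rcMeasure_real_mono_of_forall_subset_edgeSet _ hp' hq0 _ fun ω hω hmem => ?_
    obtain ⟨⟨⟨⟨hA₁ω, hS₁ω⟩, hRdω⟩, hS₂ω⟩, hA₂ω⟩ := hmem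
    have hω' : ω ⊆ F.graph.edgeSet := fun e he => by
      have h := hω he
      rw [edgeSet_fromEdgeSet] at h
      rw [ScaleFrame.graph, edgeSet_fromEdgeSet]
      exact ⟨Finset.mem_coe.2 (F.mem_edgesWithin.1 (Finset.mem_coe.1 h.1)).1, h.2⟩
    have h23 : a * M ^ 2 < a * M ^ 3 := by linarith [hak 2]
    have h1112 : a * M ^ 11 < a * M ^ 12 := by linarith [hak 11]
    refine F.openCrossing_of_arms_seps_radCross hω' h23 m3_11 h1112 (by linarith [hak 12])
      Set.inter_subset_left Set.inter_subset_left (fun v hv => ?_) (fun r hr => ?_) (fun t ht => ?_)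
      (fun x hx => ?_) (fun y hy => ?_) hA₁ω hS₁ω hRdω hS₂ω hA₂ω
    · exact hband v hv.1 (by linarith [hv.2.1, hak 2]) (by linarith [hv.2.2])
    · exact ⟨(hW r (hR'W hr)).1, by linarith [hR' r hr, hak 2]⟩
    · exact (F.mem_outSet_iff_of_lt h23).2 fun _ => ht.2
    · exact ⟨(hW x hx.1.1).1, hx.2⟩
    · exact (F.mem_outSet_iff_of_lt h1112).2 fun _ => by linarith [hY y hy]
  -- assembling
  have n0 : ∀ A : Set (BondConfig V), 0 ≤ ν.real A := fun _ => measureReal_nonneg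
  calc _ = c * (rcMeasure (fromEdgeSet (↑(F.edgesWithin U₁) : Set (Sym2 V))) p q
          (R' ∪ {v | a * M ^ 6 - F.η ≤ F.rad v})).real A₁ * c * c * c *
          (c * (rcMeasure (fromEdgeSet (↑(F.edgesWithin U₂) : Set (Sym2 V))) p q
            (Y ∪ {v | F.rad v ≤ a * M ^ 8 + F.η})).real A₂) := by ring
    _ ≤ ν.real A₁ * ν.real S₁ * ν.real Rd * ν.real S₂ * ν.real A₂ :=
        mul_le_mul (mul_le_mul (mul_le_mul (mul_le_mul h5 h3 hc.le (n0 _)) h4 hc.le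
          (mul_nonneg (n0 _) (n0 _))) h3' hc.le (mul_nonneg (mul_nonneg (n0 _) (n0 _)) (n0 _))) h6
          (mul_nonneg hc.le measureReal_nonneg)
          (mul_nonneg (mul_nonneg (mul_nonneg (n0 _) (n0 _)) (n0 _)) (n0 _))
    _ ≤ ν.real (A₁ ∩ S₁ ∩ Rd ∩ S₂ ∩ A₂) := hfkg
    _ ≤ ν.real (openCrossing W R' Y) := hglue

end ScaleFrame

/-- (QM-lower) test: Kesten's gluing (29)–(30): under the same 1-block measure, the connection `R' ↔ Y in W`
has probability at least `c^5 g₁ g₂`: the two arm events (each at least `c ×` its wired-layer version by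
boundary pushing (A⁺) at the collars `(aM^4, aM^5)`, `(aM^9, aM^10)`), open separators in the annuli
`(aM^2, aM^3)` and `(aM^11, aM^12)` (RSW (i)), and an open radial crossing of `(aM^2, aM^13)` (RSW (iii)),
glued by FKG; `W` contains the band `{good, a < rad < aM^14}`. [cite: Kesten1986, §2 eqs. (29)–(30)] -/
theorem ScaleFrame.quasiMult_lower :
    ∀ {V : Type*} [Fintype V] [DecidableEq V] (F : ScaleFrame V) {p q c a M : ℝ},
      p ∈ Set.Ico (0 : ℝ) 1 → 1 ≤ q → 0 < c → 0 < a → 4 ≤ M → a * M ^ 15 ≤ F.Rmax → F.η ≤ a →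
      F.LadderRSWb p q c a M 14 13 →
    ∀ (W R' Y : Set V),
      (∀ v ∈ W, v ∈ F.good ∧ F.rad v < a * M ^ 15) → R' ⊆ W → Y ⊆ W →
      (∀ v : V, v ∈ F.good → a < F.rad v → F.rad v < a * M ^ 14 → v ∈ W) →
      (∀ v ∈ R', F.rad v ≤ a) → (∀ v ∈ Y, a * M ^ 14 - F.η < F.rad v) →
      let ν := rcMeasure (fromEdgeSet (↑(F.edgesWithin W) : Set (Sym2 V))) p q (R' ∪ Y)
      let U₁ : Set V := W ∩ {v | F.rad v < a * M ^ 6}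
      let U₂ : Set V := W ∩ {v | a * M ^ 8 < F.rad v}
      let g₁ := (rcMeasure (fromEdgeSet (↑(F.edgesWithin U₁) : Set (Sym2 V))) p q
        (R' ∪ {v | a * M ^ 6 - F.η ≤ F.rad v})).real (openCrossing U₁ R' (U₁ ∩ {v | a * M ^ 3 ≤ F.rad v}))
      let g₂ := (rcMeasure (fromEdgeSet (↑(F.edgesWithin U₂) : Set (Sym2 V))) p q
        (Y ∪ {v | F.rad v ≤ a * M ^ 8 + F.η})).real (openCrossing U₂ (U₂ ∩ {v | F.rad v ≤ a * M ^ 11}) Y)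
      c ^ 5 * g₁ * g₂ ≤ ν.real (openCrossing W R' Y) := by
  intro V _ _ F p q c a M hp hq hc ha hM hRm hη hL W R' Y hW hR'W hYW hband hR' hY
  exact F.quasiMult_lower_aux hp hq hc ha hM hRm hη hL W R' Y hW hR'W hYW hband hR' hY

end Literature.Probability.LatticeModels

end
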